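import Mathlib.Analysis.LocallyConvex.SeparatingDual
import Literature.Analysis.FunctionSpaces.TorusInverseLaplacian
import Literature.Analysis.FunctionSpaces.TorusFourierCalculus
import Literature.Analysis.FunctionSpaces.TorusEnstrophyOrthogonality
import HarnessLib

/-!
# Calculus of the inverse Laplacian on the flat torus: linearity, commutation with derivatives,
# with continuous linear maps and with the Laplacian; vector-valued `Δ Δ⁻¹ = Δ⁻¹ Δ = 1 - ⨍`

Analysis/FunctionSpaces support file. The accepted `Torus.invLaplacian`
(`TorusInverseLaplacian`: `Δ⁻¹h = ((-4π²)^N)⁻¹ • K ⋆ Δ^{N-1}h`, with `Δ(Δ⁻¹h) = h - ∫h` proved for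
smooth *real* `h`) is used in classical PDE constructions on vector fields — the
De Lellis–Székelyhidi antidivergence `ℛ` (`FluidPDE/Antidivergence`), the Biot–Savart potential
`ℬ = (-Δ)⁻¹ curl` of Buckmaster–De Lellis–Székelyhidi–Vicol 2019, §3.3 — where one constantly
uses that `Δ⁻¹` is linear and commutes with partial derivatives, with the Laplacian and with
fixed linear maps of the values ("`ℛ curl` is a zero-order operator", BDSV §4.4; "`div zᵢ = 0` and
`curl zᵢ = vᵢ`", §3.3). This file proves these operator identities for smooth arguments:

* `Torus.laplacian_clm_comp_apply`, `Torus.convolution_clm_comp_apply`,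
  `Torus.invLaplacian_clm_comp`: `Δ`, `θ ⋆ ·` and `Δ⁻¹` commute with post-composition by a
  continuous linear map `L : F →L G` of the values;
* linearity: `Torus.laplacian_add_apply`, `Torus.invLaplacian_add`, `_neg`, `_sub`, `_zero`;
* `Torus.partialDeriv_laplacian_comm`, `Torus.partialDeriv_invLaplacian`: `∂ᵢΔ = Δ∂ᵢ`,
  `∂ᵢΔ⁻¹ = Δ⁻¹∂ᵢ` (Schwarz, `Torus.partialDeriv_comm`, and `∂ᵢ(θ ⋆ k) = θ ⋆ ∂ᵢk`);
* `Torus.invLaplacian_laplacian_comm`: `Δ⁻¹(Δh) = Δ(Δ⁻¹h)` (both are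
  `((-4π²)^N)⁻¹ • K ⋆ Δ^N h`);
* `Torus.laplacian_invLaplacian_of_completeSpace`, `Torus.invLaplacian_laplacian`: the identity
  `Δ(Δ⁻¹h) = Δ⁻¹(Δh) = h - ∫h` for smooth `h` with values in any complete real normed space
  (from the real case by duality, `SeparatingDual.eq_iff_forall_dual_eq`);
* time-dependent fields, jointly smooth on `[a,b] × T^d` (one-sided in time at the endpoints):
  `Torus.timeDerivWithin_partialDeriv_comm` (**`∂ₜ∂ⱼ = ∂ⱼ∂ₜ`**, by the symmetry of the second
  derivative of the space–time lift *within* the convex set `[a,b] × ℝ^d`, Mathlib's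
  `ContDiffWithinAt.isSymmSndFDerivWithinAt`), `Torus.timeDerivWithin_laplacian_comm`,
  `Torus.timeDerivWithin_invLaplacian` (**`∂ₜΔ⁻¹ = Δ⁻¹∂ₜ`**, through
  `Torus.timeDerivWithin_convolution_Icc`), and the linear rules `Torus.timeDerivWithin_clm_comp`,
  `_add`, `_const_smul`, `_finset_sum`. These are what makes `∂ₜ` commute with the nonlocal
  zero-order operators of BDSV §§3.3–4.4 (`ℬ`, `ℛ curl`) on the closed time slab.

## References

* A. Cheskidov, X. Luo, *Sharp nonuniqueness for the Navier–Stokes equations*, Invent. Math. 229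
  (2022), §7.2 (App. B): `Δ⁻¹` on `C^∞(𝕋^d)`. [`CheskidovLuo2022`]
* T. Buckmaster, C. De Lellis, L. Székelyhidi Jr., V. Vicol, *Onsager's conjecture for admissible
  weak solutions*, CPAM 72 (2019), §3.3 and §4.4 (consumers).
-/

noncomputable section

open MeasureTheory Set Filter Function
open scoped Convolution ContDiff

namespace Literature.Analysis.FunctionSpaces

namespace Torus

variable {d : Type*} [Fintype d] [DecidableEq d]
variable {F G : Type*} [NormedAddCommGroup F] [NormedSpace ℝ F] [NormedAddCommGroup G]
  [NormedSpace ℝ G]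

/-! ## The Laplacian: linearity and continuous linear maps of the values -/

section Laplacian

variable {f g : UnitAddTorus d → F}

/-- `Δ(L ∘ f) = L ∘ Δf` for smooth `f` and a continuous linear map `L` of the values. [folklore] -/
theorem laplacian_clm_comp_apply (hf : IsSmooth f) (L : F →L[ℝ] G) (x : UnitAddTorus d) :
    laplacian (L ∘ f) x = L (laplacian f x) := by
  rw [laplacian_eq_sum_partialDeriv_partialDeriv (hf.comp_clm L),
    laplacian_eq_sum_partialDeriv_partialDeriv hf, map_sum]
  refine Finset.sum_congr rfl fun i _ => ?_
  have h1 : partialDeriv i (L ∘ f) = L ∘ partialDeriv i f := funext (partialDeriv_clm_comp hf L i)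
  rw [h1, partialDeriv_clm_comp (hf.partialDeriv i) L i x]

/-- `Δⁿ(L ∘ f) = L ∘ Δⁿf` for smooth `f`. [folklore] -/
theorem laplacian_iterate_clm_comp (hf : IsSmooth f) (L : F →L[ℝ] G) :
    ∀ n : ℕ, laplacian^[n] (L ∘ f) = L ∘ laplacian^[n] f
  | 0 => rfl
  | n + 1 => by
    rw [iterate_succ_apply', iterate_succ_apply', laplacian_iterate_clm_comp hf L n]
    funext x
    exact laplacian_clm_comp_apply (isSmooth_laplacian_iterate hf n) L x

/-- `Δ(f + g) = Δf + Δg` for smooth `f, g`. [folklore] -/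
theorem laplacian_add_apply (hf : IsSmooth f) (hg : IsSmooth g) (x : UnitAddTorus d) :
    laplacian (f + g) x = laplacian f x + laplacian g x := by
  rw [laplacian_eq_sum_partialDeriv_partialDeriv (hf.add hg), laplacian_eq_sum_partialDeriv_partialDeriv hf,
    laplacian_eq_sum_partialDeriv_partialDeriv hg, ← Finset.sum_add_distrib]
  refine Finset.sum_congr rfl fun i _ => ?_
  rw [partialDeriv_add (hf.isContDiff (by simp)) (hg.isContDiff (by simp)),
    partialDeriv_add ((hf.partialDeriv i).isContDiff (by simp)) ((hg.partialDeriv i).isContDiff (by simp))]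
  rfl

omit [DecidableEq d] in
/-- `Δ(-f) = -Δf` for smooth `f`. [folklore] -/
theorem laplacian_neg_apply (hf : IsSmooth f) (x : UnitAddTorus d) : laplacian (-f) x = -laplacian f x := by
  rw [← neg_one_smul ℝ f, laplacian_const_smul_apply hf (-1) x, neg_one_smul]

/-- `Δⁿ(f + g) = Δⁿf + Δⁿg` for smooth `f, g`. [folklore] -/
theorem laplacian_iterate_add (hf : IsSmooth f) (hg : IsSmooth g) :
    ∀ n : ℕ, laplacian^[n] (f + g) = laplacian^[n] f + laplacian^[n] g
  | 0 => rfl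
  | n + 1 => by
    rw [iterate_succ_apply', iterate_succ_apply', iterate_succ_apply', laplacian_iterate_add hf hg n]
    funext x
    exact laplacian_add_apply (isSmooth_laplacian_iterate hf n) (isSmooth_laplacian_iterate hg n) x

omit [DecidableEq d] in
/-- `Δⁿ(c • f) = c • Δⁿf` for smooth `f`. [folklore] -/
theorem laplacian_iterate_const_smul (hf : IsSmooth f) (c : ℝ) :
    ∀ n : ℕ, laplacian^[n] (c • f) = c • laplacian^[n] f
  | 0 => rfl
  | n + 1 => by
    rw [iterate_succ_apply', iterate_succ_apply', laplacian_iterate_const_smul hf c n]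
    funext x
    exact laplacian_const_smul_apply (isSmooth_laplacian_iterate hf n) c x

omit [DecidableEq d] in
/-- `Δⁿ 0 = 0`. [folklore] -/
theorem laplacian_iterate_zero : ∀ n : ℕ, laplacian^[n] (0 : UnitAddTorus d → F) = 0
  | 0 => rfl
  | n + 1 => by
    rw [iterate_succ_apply', laplacian_iterate_zero n]
    funext x
    rw [Pi.zero_apply, ← zero_smul ℝ (0 : UnitAddTorus d → F)]
    exact (laplacian_const_smul_apply (isSmooth_const (0 : F)) 0 x).trans (zero_smul _ _)

/-- **Schwarz for the Laplacian**: `∂ᵢ(Δf) = Δ(∂ᵢf)` for smooth `f`. [folklore] -/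
theorem partialDeriv_laplacian_comm (hf : IsSmooth f) (i : d) (x : UnitAddTorus d) :
    partialDeriv i (laplacian f) x = laplacian (partialDeriv i f) x := by
  have hL : laplacian f = fun y => ∑ j, partialDeriv j (partialDeriv j f) y :=
    funext (laplacian_eq_sum_partialDeriv_partialDeriv hf)
  rw [hL, partialDeriv_finset_sum _ (fun j _ => ((hf.partialDeriv j).partialDeriv j).isContDiff (by simp)),
    laplacian_eq_sum_partialDeriv_partialDeriv (hf.partialDeriv i)]
  refine Finset.sum_congr rfl fun j _ => ?_
  rw [partialDeriv_comm ((hf.partialDeriv j)) i j x]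
  have h2 : partialDeriv i (partialDeriv j f) = partialDeriv j (partialDeriv i f) :=
    funext (partialDeriv_comm hf i j)
  rw [h2]

/-- `∂ᵢ(Δⁿf) = Δⁿ(∂ᵢf)` for smooth `f`. [folklore] -/
theorem partialDeriv_laplacian_iterate_comm (hf : IsSmooth f) (i : d) :
    ∀ n : ℕ, partialDeriv i (laplacian^[n] f) = laplacian^[n] (partialDeriv i f)
  | 0 => rfl
  | n + 1 => by
    rw [iterate_succ_apply', iterate_succ_apply', ← partialDeriv_laplacian_iterate_comm hf i n]
    funext x
    exact partialDeriv_laplacian_comm (isSmooth_laplacian_iterate hf n) i x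

end Laplacian

/-! ## Convolution and continuous linear maps of the values -/

section ConvolutionCLM

omit [DecidableEq d] in
/-- `(θ ⋆ (L ∘ k))(x) = L((θ ⋆ k)(x))` for `θ ∈ L¹` and continuous `k`. [folklore] -/
theorem convolution_clm_comp_apply [CompleteSpace F] [CompleteSpace G] {θ : UnitAddTorus d → ℝ}
    (hθ : Integrable θ volume) {k : UnitAddTorus d → F} (hk : Continuous k) (L : F →L[ℝ] G)
    (x : UnitAddTorus d) : (θ ⋆ (L ∘ k)) x = L ((θ ⋆ k) x) := by
  rw [convolution_lsmul, convolution_lsmul,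
    ← ContinuousLinearMap.integral_comp_comm L (integrable_smul_comp_sub hθ hk x)]
  congr 1
  funext t
  rw [comp_apply, map_smul]

omit [DecidableEq d] in
/-- Mollification is additive in the kernel (two continuous kernels). [folklore] -/
theorem convolution_add_right_apply {θ : UnitAddTorus d → ℝ} (hθ : Integrable θ volume)
    {k k' : UnitAddTorus d → F} (hk : Continuous k) (hk' : Continuous k') (x : UnitAddTorus d) :
    (θ ⋆ (k + k')) x = (θ ⋆ k) x + (θ ⋆ k') x := by
  simp only [convolution_lsmul, Pi.add_apply, smul_add]
  exact integral_add (integrable_smul_comp_sub hθ hk x) (integrable_smul_comp_sub hθ hk' x)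

end ConvolutionCLM

/-! ## The inverse Laplacian: continuous linear maps of the values, linearity -/

section InvLaplacianAlgebra

variable {h f g : UnitAddTorus d → F}

/-- **`Δ⁻¹(L ∘ h) = L ∘ Δ⁻¹h`** for smooth `h` and a continuous linear map `L` of the values
(`Δ⁻¹` acts "componentwise"). [folklore] -/
theorem invLaplacian_clm_comp [CompleteSpace F] [CompleteSpace G] (hh : IsSmooth h) (L : F →L[ℝ] G) :
    invLaplacian (L ∘ h) = L ∘ invLaplacian h := by
  funext x
  simp only [invLaplacian, Pi.smul_apply, comp_apply]
  rw [laplacian_iterate_clm_comp hh L,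
    convolution_clm_comp_apply integrable_invLaplacianKernel (isSmooth_laplacian_iterate hh _).continuous L x,
    map_smul]

/-- `Δ⁻¹` is additive on smooth functions. [folklore] -/
theorem invLaplacian_add (hf : IsSmooth f) (hg : IsSmooth g) :
    invLaplacian (f + g) = invLaplacian f + invLaplacian g := by
  funext x
  simp only [invLaplacian, Pi.smul_apply, Pi.add_apply]
  rw [laplacian_iterate_add hf hg,
    convolution_add_right_apply integrable_invLaplacianKernel (isSmooth_laplacian_iterate hf _).continuous
      (isSmooth_laplacian_iterate hg _).continuous, smul_add]

omit [DecidableEq d] in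
/-- `Δ⁻¹ 0 = 0`. [folklore] -/
theorem invLaplacian_zero : invLaplacian (0 : UnitAddTorus d → F) = 0 := by
  funext x
  simp only [invLaplacian, Pi.smul_apply, Pi.zero_apply]
  rw [laplacian_iterate_zero, convolution_zero, Pi.zero_apply, smul_zero]

omit [DecidableEq d] in
/-- `Δ⁻¹(-h) = -Δ⁻¹h` for smooth `h`. [folklore] -/
theorem invLaplacian_neg (hh : IsSmooth h) : invLaplacian (-h) = -invLaplacian h := by
  rw [← neg_one_smul ℝ h, invLaplacian_const_smul (-1) h hh, neg_one_smul]

/-- `Δ⁻¹(f - g) = Δ⁻¹f - Δ⁻¹g` for smooth `f, g`. [folklore] -/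
theorem invLaplacian_sub (hf : IsSmooth f) (hg : IsSmooth g) :
    invLaplacian (f - g) = invLaplacian f - invLaplacian g := by
  rw [sub_eq_add_neg, invLaplacian_add hf hg.neg, invLaplacian_neg hg, sub_eq_add_neg]

/-- `Δ⁻¹` of a finite sum of smooth functions. [folklore] -/
theorem invLaplacian_finset_sum {ι : Type*} (s : Finset ι) {A : ι → UnitAddTorus d → F}
    (hA : ∀ i ∈ s, IsSmooth (A i)) : invLaplacian (∑ i ∈ s, A i) = ∑ i ∈ s, invLaplacian (A i) := by
  classical
  induction s using Finset.induction_on with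
  | empty => simp [invLaplacian_zero]
  | insert a s ha ih =>
    have hs : ∀ i ∈ s, IsSmooth (A i) := fun i hi => hA i (Finset.mem_insert_of_mem hi)
    have hsum : IsSmooth (∑ i ∈ s, A i) := by
      rw [show (∑ i ∈ s, A i) = fun x => ∑ i ∈ s, A i x from funext fun x => Finset.sum_apply x s A]
      exact ContDiff.sum fun i hi => hs i hi
    rw [Finset.sum_insert ha, Finset.sum_insert ha, invLaplacian_add (hA a (Finset.mem_insert_self a s)) hsum,
      ih hs]

end InvLaplacianAlgebra

/-! ## Commutation with partial derivatives and with the Laplacian -/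

section Commutation

variable {h : UnitAddTorus d → F}

/-- **`∂ᵢ(Δ⁻¹h) = Δ⁻¹(∂ᵢh)`** for smooth `h` (derivatives fall on the smooth factor of the
mollification, `Torus.partialDeriv_convolution`, and commute with `Δ^{N-1}`). [folklore] -/
theorem partialDeriv_invLaplacian (hh : IsSmooth h) (i : d) (x : UnitAddTorus d) :
    partialDeriv i (invLaplacian h) x = invLaplacian (partialDeriv i h) x := by
  have hg : IsSmooth (laplacian^[Fintype.card d - 1] h) := isSmooth_laplacian_iterate hh _
  have hconv : IsSmooth (invLaplacianKernel ⋆ laplacian^[Fintype.card d - 1] h) :=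
    isSmooth_convolution integrable_invLaplacianKernel hg
  unfold invLaplacian
  rw [partialDeriv_const_smul (hconv.isContDiff (by simp)), Pi.smul_apply, Pi.smul_apply,
    partialDeriv_convolution integrable_invLaplacianKernel hg i x, partialDeriv_laplacian_iterate_comm hh i]

omit [DecidableEq d] in
/-- **`Δ⁻¹(Δh) = Δ(Δ⁻¹h)`** for smooth `h`: both are `((-4π²)^N)⁻¹ • K ⋆ Δ^N h`. [folklore] -/
theorem invLaplacian_laplacian_comm (hh : IsSmooth h) :
    invLaplacian (laplacian h) = laplacian (invLaplacian h) := by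
  have hg : IsSmooth (laplacian^[Fintype.card d - 1] h) := isSmooth_laplacian_iterate hh _
  have hconv : IsSmooth (invLaplacianKernel ⋆ laplacian^[Fintype.card d - 1] h) :=
    isSmooth_convolution integrable_invLaplacianKernel hg
  funext x
  unfold invLaplacian
  rw [laplacian_const_smul_apply hconv, Pi.smul_apply, laplacian_convolution integrable_invLaplacianKernel hg x,
    ← iterate_succ_apply' laplacian, ← iterate_succ_apply laplacian]

/-- **`Δ(Δ⁻¹h) = h - ∫h` for smooth `h` with values in a complete real normed space** (the accepted
real case `Torus.laplacian_invLaplacian` applied to `L ∘ h` for every continuous linear functional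
`L`, and separation of points by the dual). [cite: CheskidovLuo2022, §7.2] -/
theorem laplacian_invLaplacian_of_completeSpace [Nonempty d] [CompleteSpace F] (hh : IsSmooth h)
    (x : UnitAddTorus d) : laplacian (invLaplacian h) x = h x - ∫ y, h y := by
  refine (SeparatingDual.eq_iff_forall_dual_eq (R := ℝ)).2 fun L => ?_
  have hLh : IsSmooth ((L : F →L[ℝ] ℝ) ∘ h) := hh.comp_clm L
  have h1 : L (laplacian (invLaplacian h) x) = laplacian (invLaplacian ((L : F →L[ℝ] ℝ) ∘ h)) x := by
    rw [invLaplacian_clm_comp hh, laplacian_clm_comp_apply (isSmooth_invLaplacian hh)]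
  rw [h1, laplacian_invLaplacian hLh x, map_sub, comp_apply,
    ← ContinuousLinearMap.integral_comp_comm L hh.integrable]
  rfl

/-- **`Δ⁻¹(Δh) = h - ∫h`** for smooth `h` with values in a complete real normed space. [folklore] -/
theorem invLaplacian_laplacian [Nonempty d] [CompleteSpace F] (hh : IsSmooth h) (x : UnitAddTorus d) :
    invLaplacian (laplacian h) x = h x - ∫ y, h y := by
  rw [invLaplacian_laplacian_comm hh, laplacian_invLaplacian_of_completeSpace hh]

/-- A smooth mean-zero function is recovered from its Laplacian: `Δ⁻¹(Δh) = h` if `∫h = 0`. [folklore] -/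
theorem invLaplacian_laplacian_of_integral_eq_zero [Nonempty d] [CompleteSpace F] (hh : IsSmooth h)
    (h0 : ∫ y, h y = 0) : invLaplacian (laplacian h) = h := by
  funext x
  rw [invLaplacian_laplacian hh, h0, sub_zero]

end Commutation

/-! ## Time-dependent fields: `∂ₜ` commutes with `∂ⱼ`, `Δ`, continuous linear maps and `Δ⁻¹` -/

section Time

variable {a b : ℝ} {u : ℝ → UnitAddTorus d → F}

omit [DecidableEq d] in
/-- The one-sided time derivative commutes with a continuous linear map of the values (on time
sets of unique differentiability). [folklore] -/
theorem timeDerivWithin_clm_comp {S : Set ℝ} (hu : IsSmoothSpaceTimeOn S u) (hS : UniqueDiffOn ℝ S)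
    (L : F →L[ℝ] G) {t : ℝ} (ht : t ∈ S) (x : UnitAddTorus d) :
    timeDerivWithin S (fun s y => L (u s y)) t x = L (timeDerivWithin S u t x) := by
  unfold timeDerivWithin
  exact ((L.hasFDerivAt.comp_hasDerivWithinAt t (hu.hasDerivWithinAt_slice ht x))).derivWithin (hS t ht)

omit [DecidableEq d] in
/-- The one-sided time derivative of a sum of jointly smooth fields. [folklore] -/
theorem timeDerivWithin_add {S : Set ℝ} {v : ℝ → UnitAddTorus d → F} (hu : IsSmoothSpaceTimeOn S u)
    (hv : IsSmoothSpaceTimeOn S v) (hS : UniqueDiffOn ℝ S) {t : ℝ} (ht : t ∈ S) (x : UnitAddTorus d) :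
    timeDerivWithin S (fun s y => u s y + v s y) t x = timeDerivWithin S u t x + timeDerivWithin S v t x := by
  unfold timeDerivWithin
  exact ((hu.hasDerivWithinAt_slice ht x).add (hv.hasDerivWithinAt_slice ht x)).derivWithin (hS t ht)

omit [DecidableEq d] in
/-- The one-sided time derivative of a constant multiple. [folklore] -/
theorem timeDerivWithin_const_smul {S : Set ℝ} (hu : IsSmoothSpaceTimeOn S u) (hS : UniqueDiffOn ℝ S)
    (c : ℝ) {t : ℝ} (ht : t ∈ S) (x : UnitAddTorus d) :
    timeDerivWithin S (fun s y => c • u s y) t x = c • timeDerivWithin S u t x := by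
  unfold timeDerivWithin
  exact ((hu.hasDerivWithinAt_slice ht x).const_smul c).derivWithin (hS t ht)

omit [DecidableEq d] in
/-- The one-sided time derivative of a finite sum of jointly smooth fields. [folklore] -/
theorem timeDerivWithin_finset_sum {S : Set ℝ} {ι : Type*} (s : Finset ι) {U : ι → ℝ → UnitAddTorus d → F}
    (hU : ∀ i ∈ s, IsSmoothSpaceTimeOn S (U i)) (hS : UniqueDiffOn ℝ S) {t : ℝ} (ht : t ∈ S)
    (x : UnitAddTorus d) :
    timeDerivWithin S (fun τ y => ∑ i ∈ s, U i τ y) t x = ∑ i ∈ s, timeDerivWithin S (U i) t x := by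
  unfold timeDerivWithin
  have h := HasDerivWithinAt.fun_sum (u := s) (A := fun i τ => U i τ x)
    (A' := fun i => derivWithin (fun τ => U i τ x) S t) (x := t) (s := S)
    fun i hi => (hU i hi).hasDerivWithinAt_slice ht x
  exact h.derivWithin (hS t ht)

/-- **`∂ₜ∂ⱼ = ∂ⱼ∂ₜ` for jointly smooth fields on `[a,b] × T^d`** (one-sided in time at the
endpoints): the second derivative of the space–time lift within `[a,b] × ℝ^d` is symmetric
(Mathlib's `ContDiffWithinAt.isSymmSndFDerivWithinAt`, the set being convex with dense
interior), and its `((1,0),(0,eⱼ))` and `((0,eⱼ),(1,0))` entries are the two mixed derivatives.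
[folklore] -/
theorem timeDerivWithin_partialDeriv_comm (hab : a < b) (hu : IsSmoothSpaceTimeOn (Icc a b) u)
    {t : ℝ} (ht : t ∈ Icc a b) (j : d) (x : UnitAddTorus d) :
    timeDerivWithin (Icc a b) (fun s => partialDeriv j (u s)) t x =
      partialDeriv j (timeDerivWithin (Icc a b) u t) x := by
  obtain ⟨y, rfl⟩ := proj_surjective x
  set S : Set ℝ := Icc a b with hSdef
  set S' : Set (ℝ × EuclideanSpace ℝ d) := S ×ˢ univ with hS'def
  have hS : UniqueDiffOn ℝ S := uniqueDiffOn_Icc hab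
  have hS' : UniqueDiffOn ℝ S' := hS.prod uniqueDiffOn_univ
  set Ψ : ℝ → UnitAddTorus d → (ℝ × EuclideanSpace ℝ d →L[ℝ] F) := stDeriv S u with hΨdef
  have hΨ : IsSmoothSpaceTimeOn S Ψ := hu.stDeriv hS
  have hty : (t, y) ∈ S' := mk_mem_prod ht (mem_univ _)
  -- first and second derivatives of the lift
  have hD1 : EqOn (fderivWithin ℝ (stLift u) S') (stLift Ψ) S' := by
    rintro ⟨s, z⟩ hp
    exact hu.fderivWithin_stLift hS (mem_prod.1 hp).1 z
  have hD2 : fderivWithin ℝ (fderivWithin ℝ (stLift u) S') S' (t, y) = stDeriv S Ψ t (proj y) := by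
    rw [fderivWithin_congr hD1 (hD1 hty)]
    exact hΨ.fderivWithin_stLift hS ht y
  -- symmetry of the second derivative within `S'`
  have hsymm : IsSymmSndFDerivWithinAt ℝ (stLift u) S' (t, y) := by
    have h22 : minSmoothness ℝ 2 ≤ ((⊤ : ℕ∞) : ℕ∞ω) := by
      rw [minSmoothness_of_isRCLikeNormedField]
      exact WithTop.coe_le_coe.mpr le_top
    refine (hu (t, y) hty).isSymmSndFDerivWithinAt h22 hS' ?_ hty
    have hcl : closure (interior S') = S' := by
      rw [hS'def, interior_prod_eq, interior_univ, closure_prod_eq, closure_univ, hSdef, interior_Icc,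
        closure_Ioo hab.ne]
    rw [hcl]
    exact hty
  have key := hsymm.eq ((1 : ℝ), (0 : EuclideanSpace ℝ d)) ((0 : ℝ), EuclideanSpace.single j (1 : ℝ))
  rw [hD2, stDeriv_apply_one_zero, stDeriv_apply, zero_smul, zero_add] at key
  -- `key : timeDerivWithin S Ψ t (proj y) (0, eⱼ) = Torus.fderiv (Ψ t) (proj y) eⱼ (1, 0)`
  -- left-hand side
  have hslice : ∀ s ∈ S, IsContDiff 1 (u s) := fun s hs => (hu.isSmooth_slice hs).isContDiff (by simp)
  have hL : timeDerivWithin S (fun s => partialDeriv j (u s)) t (proj y) =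
      timeDerivWithin S Ψ t (proj y) ((0 : ℝ), EuclideanSpace.single j (1 : ℝ)) := by
    have e1 : timeDerivWithin S (fun s => partialDeriv j (u s)) t (proj y) =
        derivWithin (fun s => Ψ s (proj y) ((0 : ℝ), EuclideanSpace.single j (1 : ℝ))) S t := by
      unfold timeDerivWithin
      refine derivWithin_congr (fun s hs => ?_) ?_
      · show partialDeriv j (u s) (proj y) = _
        rw [hΨdef, stDeriv_apply, zero_smul, zero_add, partialDeriv_eq_fderiv_apply (hslice s hs)]
      · show partialDeriv j (u t) (proj y) = _
        rw [hΨdef, stDeriv_apply, zero_smul, zero_add, partialDeriv_eq_fderiv_apply (hslice t ht)]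
    rw [e1]
    exact ((ContinuousLinearMap.apply ℝ F ((0 : ℝ), EuclideanSpace.single j (1 : ℝ))).hasFDerivAt.comp_hasDerivWithinAt
      t (hΨ.hasDerivWithinAt_slice ht (proj y))).derivWithin (hS t ht)
  -- right-hand side
  have hR : partialDeriv j (timeDerivWithin S u t) (proj y) =
      Torus.fderiv (Ψ t) (proj y) (EuclideanSpace.single j 1) ((1 : ℝ), (0 : EuclideanSpace ℝ d)) := by
    have e1 : timeDerivWithin S u t = (ContinuousLinearMap.apply ℝ F ((1 : ℝ), (0 : EuclideanSpace ℝ d))) ∘ Ψ t := by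
      funext z
      simp [hΨdef]
    rw [e1, partialDeriv_clm_comp (hΨ.isSmooth_slice ht) _ j (proj y),
      partialDeriv_eq_fderiv_apply ((hΨ.isSmooth_slice ht).isContDiff (by simp))]
    rfl
  rw [hL, hR, key]

/-- `∂ₜΔ = Δ∂ₜ` for jointly smooth fields on `[a,b] × T^d`. [folklore] -/
theorem timeDerivWithin_laplacian_comm (hab : a < b) (hu : IsSmoothSpaceTimeOn (Icc a b) u)
    {t : ℝ} (ht : t ∈ Icc a b) (x : UnitAddTorus d) :
    timeDerivWithin (Icc a b) (fun s => laplacian (u s)) t x = laplacian (timeDerivWithin (Icc a b) u t) x := by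
  have hS : UniqueDiffOn ℝ (Icc a b) := uniqueDiffOn_Icc hab
  have hD : ∀ i, IsSmoothSpaceTimeOn (Icc a b) (fun s => partialDeriv i (u s)) := fun i => hu.partialDeriv hS i
  have hDD : ∀ i, IsSmoothSpaceTimeOn (Icc a b) (fun s => partialDeriv i (partialDeriv i (u s))) :=
    fun i => (hD i).partialDeriv hS i
  have e1 : timeDerivWithin (Icc a b) (fun s => laplacian (u s)) t x =
      timeDerivWithin (Icc a b) (fun s y => ∑ i, partialDeriv i (partialDeriv i (u s)) y) t x := by
    unfold timeDerivWithin
    exact derivWithin_congr (fun s hs => laplacian_eq_sum_partialDeriv_partialDeriv (hu.isSmooth_slice hs) x)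
      (laplacian_eq_sum_partialDeriv_partialDeriv (hu.isSmooth_slice ht) x)
  rw [e1, timeDerivWithin_finset_sum Finset.univ (fun i _ => hDD i) hS ht x,
    laplacian_eq_sum_partialDeriv_partialDeriv ((hu.timeDerivWithin hS).isSmooth_slice ht) x]
  refine Finset.sum_congr rfl fun i _ => ?_
  rw [timeDerivWithin_partialDeriv_comm hab (hD i) ht i x]
  have e2 : timeDerivWithin (Icc a b) (fun s => partialDeriv i (u s)) t =
      partialDeriv i (timeDerivWithin (Icc a b) u t) :=
    funext fun z => timeDerivWithin_partialDeriv_comm hab hu ht i z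
  rw [e2]

/-- `∂ₜΔⁿ = Δⁿ∂ₜ` for jointly smooth fields on `[a,b] × T^d`. [folklore] -/
theorem timeDerivWithin_laplacian_iterate_comm (hab : a < b) (hu : IsSmoothSpaceTimeOn (Icc a b) u) :
    ∀ n : ℕ, ∀ {t : ℝ}, t ∈ Icc a b → ∀ x : UnitAddTorus d,
      timeDerivWithin (Icc a b) (fun s => laplacian^[n] (u s)) t x = (laplacian^[n] (timeDerivWithin (Icc a b) u t)) x
  | 0, _, _, _ => rfl
  | n + 1, t, ht, x => by
    have hS : UniqueDiffOn ℝ (Icc a b) := uniqueDiffOn_Icc hab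
    have e : (fun s => laplacian^[n + 1] (u s)) = fun s => laplacian (laplacian^[n] (u s)) :=
      funext fun s => iterate_succ_apply' laplacian n (u s)
    rw [e, timeDerivWithin_laplacian_comm hab (hu.laplacian_iterate hS n) ht x, iterate_succ_apply']
    have e2 : timeDerivWithin (Icc a b) (fun s => laplacian^[n] (u s)) t = laplacian^[n] (timeDerivWithin (Icc a b) u t) :=
      funext fun z => timeDerivWithin_laplacian_iterate_comm hab hu n ht z
    rw [e2]

/-- **`∂ₜΔ⁻¹ = Δ⁻¹∂ₜ` for jointly smooth fields on `[a,b] × T^d`** (one-sided in time at the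
endpoints): the time derivative passes through the constant, through the mollification by the
integrable kernel (`Torus.timeDerivWithin_convolution_Icc`) and through `Δ^{N-1}`. [folklore] -/
theorem timeDerivWithin_invLaplacian (hab : a < b) (hu : IsSmoothSpaceTimeOn (Icc a b) u) {t : ℝ}
    (ht : t ∈ Icc a b) (x : UnitAddTorus d) :
    timeDerivWithin (Icc a b) (fun s => invLaplacian (u s)) t x = invLaplacian (timeDerivWithin (Icc a b) u t) x := by
  have hS : UniqueDiffOn ℝ (Icc a b) := uniqueDiffOn_Icc hab
  have hint : (interior (Icc a b)).Nonempty := by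
    rw [interior_Icc]; exact nonempty_Ioo.2 hab
  set N := Fintype.card d
  set c : ℝ := ((-(4 * Real.pi ^ 2)) ^ N)⁻¹
  have hg : IsSmoothSpaceTimeOn (Icc a b) (fun s => laplacian^[N - 1] (u s)) := hu.laplacian_iterate hS _
  have hconv : IsSmoothSpaceTimeOn (Icc a b) (fun s => invLaplacianKernel ⋆ laplacian^[N - 1] (u s)) :=
    hg.convolution integrable_invLaplacianKernel (convex_Icc a b) hint
  have e0 : (fun s => invLaplacian (u s)) = fun s y => c • (invLaplacianKernel ⋆ laplacian^[N - 1] (u s)) y := rfl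
  rw [e0, timeDerivWithin_const_smul hconv hS c ht x, timeDerivWithin_convolution_Icc integrable_invLaplacianKernel hab hg ht x]
  have e2 : timeDerivWithin (Icc a b) (fun s => laplacian^[N - 1] (u s)) t = laplacian^[N - 1] (timeDerivWithin (Icc a b) u t) :=
    funext fun z => timeDerivWithin_laplacian_iterate_comm hab hu (N - 1) ht z
  rw [e2]
  rfl

end Time

end Torus

end Literature.Analysis.FunctionSpaces
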